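import Literature.AlgebraicGeometry.RelativeSpec.GeometricQuotientFlatBaseChange
import Literature.AlgebraicGeometry.RelativeSpec.GeometricQuotientUniversalBaseChange
import Literature.AlgebraicGeometry.RelativeSpec.FiniteGroupQuotientGluedProperties
import Literature.AlgebraicGeometry.RelativeSpec.SymmetricPowerGlued
import Literature.AlgebraicGeometry.Motives.GoodReduction
import Mathlib.CategoryTheory.Conj
import HarnessLib

/-!
# The quotient of an integral model by a finite group is an integral model of the quotient
# (SGA 1, Exp. V, Prop. 1.9 and Cor. 1.5; [MFK94] Ch. 0 §2 Def. 0.7, Ch. 1 §2 Ampl. 1.3)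

Topic `Literature/AlgebraicGeometry/Motives` (integral models, `Motives/GoodReduction`). PROOF file:
theorems only, no definitions, no named facts; everything below is transport of the tree's
finite-group-quotient machinery (`RelativeSpec/FiniteGroupQuotient*`, `RelativeSpec/GeometricQuotient*`)
to the language of integral models (`IntegralModel R K X`: an `R`-scheme `𝒳` with an isomorphism of
`K`-schemes `𝒳 ×_R K ≅ X`, Serre–Tate 1968 §1).

SETTING. `R` is a commutative ring, `K` an `R`-algebra which is a field and FLAT over `R` (intended:
`R` a domain or a discrete valuation ring and `K = Frac R`), `G` a finite group acting on an
`R`-scheme `𝒯` (separated over `R`) by `R`-automorphisms (`ρ : RelativeSpec.ActionOver 𝒯.hom G`)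
such that `𝒯` is covered by `G`-stable opens affine over `R` (`hcov`, Mumford's hypothesis «every
orbit lies in an affine open»; automatic for `𝒯` projective over `R`). The tree then provides the
quotient `𝒯/G` (`ρ.glued`, glued from the rings of invariants), the finite surjective `G`-invariant
quotient map `π : 𝒯 → 𝒯/G` (`ρ.gluedMk hcov`, a geometric quotient in Mumford's sense,
`isGeometricQuotient_gluedMk`) and the structure map `𝒯/G → Spec R` (`ρ.gluedDesc 𝒯.hom ρ.aut_comp`).

RESULTS.
* (private) `isPullback_fst_overPullback_map` — for `i : S′ → S` and `φ : A → B` over `S`, the square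
  `A ×_S S′ → A`, `A ×_S S′ → B ×_S S′`, `φ`, `B ×_S S′ → B` is cartesian; `isPullback_baseChange_gluedMk`
  — its instance for `π : 𝒯 → 𝒯/G` along `Spec R′ → Spec R`;
* `isGeometricQuotient_baseChange_gluedMk_of_flat` — **the generic fibre (indeed any FLAT base
  change) of `π` is a geometric quotient** of the base change of `𝒯` for the base-changed action
  (SGA 1 V 1.9, ★ `ActionOver.isGeometricQuotient_baseChange_of_flat`);
* `isGeometricQuotient_baseChange_gluedMk_of_isUnit_card` — **for `|G| ∈ Rˣ` (tame action) EVERY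
  base change of `π` is a geometric quotient**, in particular the special fibre `(𝒯/G) ×_R R/𝔪` is
  the quotient of the reduction `𝒯 ×_R R/𝔪` ([MFK94] Ch. 1 §2 Amplification 1.3, ★
  `ActionOver.isGeometricQuotient_baseChange_of_isUnit_card`);
* `exists_integralModel_of_isGeometricQuotient` — **MAIN**: if `q : 𝒯 ×_R K → X` is ANY geometric
  quotient over `K` of the generic fibre by the base-changed action (e.g. a level-lowering map of
  Shimura varieties recognised as a quotient), then `𝒯/G → Spec R` together with the canonical
  identification `(𝒯/G) ×_R K ≅ X` (uniqueness of geometric quotients, ★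
  `IsGeometricQuotient.uniqueUpToIso`) IS an integral model `𝒳` of `X`, `π` is a morphism of models
  `ū : 𝒯 → 𝒳.total` whose generic fibre is `q`, and all base-change statements above hold for `ū`.
  The conclusion carries two TRANSFER CLAUSES `∀ P : MorphismProperty Scheme, P (ρ.gluedDesc …) →
  P 𝒳.total.hom` and `∀ P, P (ρ.gluedMk hcov) → P ū.left`, so that every property proved in the tree
  for the glued forms (★ `isProper_gluedDesc`, `isFinite_gluedMk`, `isAffineHom_gluedMk`, flatness
  and smoothness results of other files, …) ports to the packaged model BY NAME;
* `exists_integralModel_of_isGeometricQuotient_of_isProper` — the same with `𝒳.total → Spec R`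
  PROPER when `𝒯 → Spec R` is proper and `R` is Noetherian (SGA 1 V Cor. 1.5, ★ `isProper_gluedDesc`)
  and `ū` finite surjective;
* `IntegralModel.exists_quotient` (+ `_of_isProper`) — the same statements starting from an
  integral model `𝒳₁ : IntegralModel R K X₁` of a `K`-scheme `X₁` with a `G`-action `σ` on `X₁`
  compatible with `ρ` through `𝒳₁.genericIso`, and a geometric quotient `q : X₁ → X` over `K`.

NOT claimed here (separate results): smoothness of `𝒳.total → Spec R` (tame quotient of a smooth
relative curve) and flatness of `ū`.

Mathlib searched (pin): `Over.pullback` (`Over.pullback_map_left`, `Over.w`), `Over.isoMk`,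
`Over.homMk`, `IsPullback.of_bot`, `IsPullback.of_hasPullback`, `Flat.SpecMap_iff`,
`RingHom.flat_algebraMap_iff`, `Iso.conjAut` (all used); Mathlib has no quotients of schemes by
finite groups and no integral models.

## References

* A. Grothendieck, *SGA 1*, Exp. V, §1, Prop. 1.9 (quotient commutes with flat base change),
  Cor. 1.5 (`X/G` proper when `X` is). [SGA1]
* D. Mumford, J. Fogarty, F. Kirwan, *Geometric Invariant Theory*, 3rd ed. (1994), Ch. 0 §2
  Def. 0.7 (universal / uniform quotients), Ch. 1 §2 Amplification 1.3. [MumfordFogartyKirwan1994]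
* D. Mumford, *Abelian Varieties* (1970), §7, Theorem p. 66 (quotient by a finite group, uniqueness). [MumfordAV1970]
* J.-P. Serre, J. Tate, *Good reduction of abelian varieties*, Ann. of Math. 88 (1968), §1 (models). [SerreTate1968]
-/

noncomputable section

universe u

open CategoryTheory CategoryTheory.Limits AlgebraicGeometry

namespace Literature.AlgebraicGeometry.Motives

open Literature.AlgebraicGeometry.RelativeSpec

set_option autoImplicit false

/-! ### §0 A category-theory feeder: base change of a morphism over `S` is a cartesian square -/

section Feeder

variable {C : Type*} [Category C] [HasPullbacks C]

set_option backward.isDefEq.respectTransparency false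

/-- For `i : S′ → S` and a morphism `φ : A → B` of objects over `S`, the square with top
`A ×_S S′ → A`, left `A ×_S S′ → B ×_S S′` (the morphism `(Over.pullback i).map φ`), right `φ` and
bottom `B ×_S S′ → B` is cartesian: paste the base-change squares of `A` and `B` along `i`
(`IsPullback.of_bot`). Private plumbing. [folklore] -/
private theorem isPullback_fst_overPullback_map {S S' : C} (i : S' ⟶ S) {A B : Over S} (φ : A ⟶ B) :
    IsPullback (pullback.fst A.hom i) ((Over.pullback i).map φ).left φ.left (pullback.fst B.hom i) := by
  have hsnd : ((Over.pullback i).map φ).left ≫ pullback.snd B.hom i = pullback.snd A.hom i :=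
    Over.w ((Over.pullback i).map φ)
  have hfst : ((Over.pullback i).map φ).left ≫ pullback.fst B.hom i = pullback.fst A.hom i ≫ φ.left :=
    pullback.lift_fst _ _ _
  have s : IsPullback (pullback.fst A.hom i) (((Over.pullback i).map φ).left ≫ pullback.snd B.hom i)
      (φ.left ≫ B.hom) i := by
    convert IsPullback.of_hasPullback A.hom i using 2
    all_goals first | exact hsnd | exact Over.w φ
  exact IsPullback.of_bot s hfst.symm (IsPullback.of_hasPullback B.hom i)

end Feeder

/-! ### §1 Base change of the quotient map `π : 𝒯 → 𝒯/G` -/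

section Quotient

variable {R : Type u} [CommRing R] {G : Type*} [Group G] [Finite G]
  (𝒯 : SchemeOver R) [IsSeparated 𝒯.hom] (ρ : ActionOver 𝒯.hom G)
  (hcov : ∀ x : 𝒯.left, ∃ O : ρ.StableAffineOpens, x ∈ O.1)

-- `(ρ.aut g).hom` with `ρ.aut g : Aut _` is only type-correct after unfolding `Aut` (as in the
-- tree's `RelativeSpec/FiniteGroupQuotientGluing`).
set_option backward.isDefEq.respectTransparency false

/-- **The base-change square of `π`.** For an `R`-algebra `R′`, the square
`𝒯 ×_R R′ → 𝒯`, `π ×_R R′ : 𝒯 ×_R R′ → (𝒯/G) ×_R R′`, `π`, `(𝒯/G) ×_R R′ → 𝒯/G` is cartesian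
(pasting of base-change squares, for the `R`-morphism `π : 𝒯 → 𝒯/G`) — the cartesian square
`X′ = X ×_Y Y′` of SGA 1, Exp. V, §1 (setting of Prop. 1.9) for `Y′ = Y ×_R R′`, `Y = 𝒯/G`.
[cite: SGA1, Exp. V §1 Prop. 1.9] -/
theorem isPullback_baseChange_gluedMk (R' : Type u) [CommRing R'] [Algebra R R'] :
    IsPullback (pullback.fst 𝒯.hom (Spec.map (CommRingCat.ofHom (algebraMap R R'))))
      ((baseChange R R').map (Over.homMk (ρ.gluedMk hcov)
        (ρ.gluedMk_gluedDesc hcov 𝒯.hom ρ.aut_comp) :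
          𝒯 ⟶ Over.mk (ρ.gluedDesc 𝒯.hom ρ.aut_comp))).left
      (ρ.gluedMk hcov)
      (pullback.fst (ρ.gluedDesc 𝒯.hom ρ.aut_comp)
        (Spec.map (CommRingCat.ofHom (algebraMap R R')))) :=
  isPullback_fst_overPullback_map (Spec.map (CommRingCat.ofHom (algebraMap R R')))
    (Over.homMk (ρ.gluedMk hcov) (ρ.gluedMk_gluedDesc hcov 𝒯.hom ρ.aut_comp) :
      𝒯 ⟶ Over.mk (ρ.gluedDesc 𝒯.hom ρ.aut_comp))

/-- An action of `G` on `𝒯 ×_R R′` over `R′` lying over `ρ` along the projection to `𝒯` leaves the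
base-changed quotient map `π ×_R R′` invariant (check on the two projections of the fibre
product `(𝒯/G) ×_R R′`): the base-changed action of SGA 1, Exp. V, §1 («`G` opère sur
`X′ = X ×_Y Y′` par transport de structure») is an action over `Y′`. [cite: SGA1, Exp. V §1 Prop. 1.9] -/
theorem aut_hom_comp_baseChange_gluedMk (R' : Type u) [CommRing R'] [Algebra R R']
    (σ : ActionOver ((baseChange R R').obj 𝒯).hom G)
    (hσ : ∀ g : G, (σ.aut g).hom ≫ pullback.fst 𝒯.hom (Spec.map (CommRingCat.ofHom (algebraMap R R'))) =
      pullback.fst 𝒯.hom (Spec.map (CommRingCat.ofHom (algebraMap R R'))) ≫ (ρ.aut g).hom) (g : G) :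
    (σ.aut g).hom ≫ ((baseChange R R').map (Over.homMk (ρ.gluedMk hcov)
        (ρ.gluedMk_gluedDesc hcov 𝒯.hom ρ.aut_comp) :
          𝒯 ⟶ Over.mk (ρ.gluedDesc 𝒯.hom ρ.aut_comp))).left =
      ((baseChange R R').map (Over.homMk (ρ.gluedMk hcov)
        (ρ.gluedMk_gluedDesc hcov 𝒯.hom ρ.aut_comp) :
          𝒯 ⟶ Over.mk (ρ.gluedDesc 𝒯.hom ρ.aut_comp))).left := by
  have H := isPullback_baseChange_gluedMk 𝒯 ρ hcov R'
  -- the two projections of `π ×_R R′`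
  have hw₁ : ((baseChange R R').map (Over.homMk (ρ.gluedMk hcov)
        (ρ.gluedMk_gluedDesc hcov 𝒯.hom ρ.aut_comp) :
          𝒯 ⟶ Over.mk (ρ.gluedDesc 𝒯.hom ρ.aut_comp))).left ≫
        pullback.fst (Over.mk (ρ.gluedDesc 𝒯.hom ρ.aut_comp)).hom
          (Spec.map (CommRingCat.ofHom (algebraMap R R'))) =
      pullback.fst 𝒯.hom (Spec.map (CommRingCat.ofHom (algebraMap R R'))) ≫ ρ.gluedMk hcov := H.w.symm
  have hw₂ : ((baseChange R R').map (Over.homMk (ρ.gluedMk hcov)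
        (ρ.gluedMk_gluedDesc hcov 𝒯.hom ρ.aut_comp) :
          𝒯 ⟶ Over.mk (ρ.gluedDesc 𝒯.hom ρ.aut_comp))).left ≫
        pullback.snd (Over.mk (ρ.gluedDesc 𝒯.hom ρ.aut_comp)).hom
          (Spec.map (CommRingCat.ofHom (algebraMap R R'))) =
      pullback.snd 𝒯.hom (Spec.map (CommRingCat.ofHom (algebraMap R R'))) :=
    Over.w ((baseChange R R').map (Over.homMk (ρ.gluedMk hcov)
        (ρ.gluedMk_gluedDesc hcov 𝒯.hom ρ.aut_comp) :
          𝒯 ⟶ Over.mk (ρ.gluedDesc 𝒯.hom ρ.aut_comp)))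
  apply pullback.hom_ext
  · -- first projection: `σ(g) ≫ π' ≫ fst = σ(g) ≫ fst ≫ π = fst ≫ ρ(g) ≫ π = fst ≫ π = π' ≫ fst`
    rw [Category.assoc, hw₁, reassoc_of% (hσ g), ρ.aut_hom_gluedMk hcov g]
  · -- second projection: the structure maps to `Spec R′`
    rw [Category.assoc, hw₂]
    exact σ.aut_comp g

/-- **Flat base change of `π` is a geometric quotient** (SGA 1, Exp. V, Prop. 1.9): for a FLAT
`R`-algebra `R′` (e.g. `R′ = K = Frac R`: the generic fibre) and any action `σ` of `G` on `𝒯 ×_R R′`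
over `R′` lying over `ρ` (the base-changed action), `π ×_R R′ : 𝒯 ×_R R′ → (𝒯/G) ×_R R′` is a
geometric quotient of `𝒯 ×_R R′` by `G` (★ `ActionOver.isGeometricQuotient_baseChange_of_flat`
applied to the cartesian square `isPullback_baseChange_gluedMk`). [cite: SGA1, Exp. V Prop. 1.9]
[cite: MumfordFogartyKirwan1994, Ch. 0 §2 Def. 0.7] -/
theorem isGeometricQuotient_baseChange_gluedMk_of_flat (R' : Type u) [CommRing R'] [Algebra R R']
    [Module.Flat R R'] (σ : ActionOver ((baseChange R R').obj 𝒯).hom G)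
    (hσ : ∀ g : G, (σ.aut g).hom ≫ pullback.fst 𝒯.hom (Spec.map (CommRingCat.ofHom (algebraMap R R'))) =
      pullback.fst 𝒯.hom (Spec.map (CommRingCat.ofHom (algebraMap R R'))) ≫ (ρ.aut g).hom) :
    σ.IsGeometricQuotient ((baseChange R R').map (Over.homMk (ρ.gluedMk hcov)
        (ρ.gluedMk_gluedDesc hcov 𝒯.hom ρ.aut_comp) :
          𝒯 ⟶ Over.mk (ρ.gluedDesc 𝒯.hom ρ.aut_comp))).left := by
  haveI : Flat (Spec.map (CommRingCat.ofHom (algebraMap R R'))) := by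
    rw [Flat.SpecMap_iff, CommRingCat.hom_ofHom]
    exact RingHom.flat_algebraMap_iff.mpr inferInstance
  haveI : Flat (pullback.fst (ρ.gluedDesc 𝒯.hom ρ.aut_comp)
      (Spec.map (CommRingCat.ofHom (algebraMap R R')))) :=
    MorphismProperty.pullback_fst _ _ inferInstance
  have hinv := aut_hom_comp_baseChange_gluedMk 𝒯 ρ hcov R' σ hσ
  have h := ρ.isGeometricQuotient_baseChange_of_flat (ρ.isGeometricQuotient_gluedMk hcov)
    (isPullback_baseChange_gluedMk 𝒯 ρ hcov R') ⟨σ.aut, hinv⟩ hσ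
  exact (σ.isGeometricQuotient_overMap_iff _ hinv _).mp h

/-- **Tame case: every base change of `π` is a geometric quotient** ([MFK94] Ch. 1 §2
Amplification 1.3 / Ch. 0 §2 Def. 0.7, universal geometric quotient): if `|G|` is invertible in `R`,
then for ANY `R`-algebra `R′` (e.g. `R′ = R/𝔪`: the special fibre, `IntegralModel.reduction`) and any
action `σ` of `G` on `𝒯 ×_R R′` over `R′` lying over `ρ`, `π ×_R R′` is a geometric quotient of
`𝒯 ×_R R′` by `G` (★ `ActionOver.isGeometricQuotient_baseChange_of_isUnit_card`; `|G|` is a unit of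
`Γ(𝒯/G, 𝒪)` through `𝒯/G → Spec R`). [cite: MumfordFogartyKirwan1994, Ch. 1 §2 Amplification 1.3]
[cite: MumfordAV1970, §7 Thm. p. 66] -/
theorem isGeometricQuotient_baseChange_gluedMk_of_isUnit_card (hG : IsUnit ((Nat.card G : ℕ) : R))
    (R' : Type u) [CommRing R'] [Algebra R R'] (σ : ActionOver ((baseChange R R').obj 𝒯).hom G)
    (hσ : ∀ g : G, (σ.aut g).hom ≫ pullback.fst 𝒯.hom (Spec.map (CommRingCat.ofHom (algebraMap R R'))) =
      pullback.fst 𝒯.hom (Spec.map (CommRingCat.ofHom (algebraMap R R'))) ≫ (ρ.aut g).hom) :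
    σ.IsGeometricQuotient ((baseChange R R').map (Over.homMk (ρ.gluedMk hcov)
        (ρ.gluedMk_gluedDesc hcov 𝒯.hom ρ.aut_comp) :
          𝒯 ⟶ Over.mk (ρ.gluedDesc 𝒯.hom ρ.aut_comp))).left := by
  -- `|G|` is a unit of the global sections of `𝒯/G`
  let φ : R →+* Γ(ρ.glued, ⊤) :=
    (ρ.gluedDesc 𝒯.hom ρ.aut_comp).appTop.hom.comp (Scheme.ΓSpecIso (CommRingCat.of R)).inv.hom
  have hG' : IsUnit ((Nat.card G : ℕ) : Γ(ρ.glued, ⊤)) := by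
    have h := hG.map φ
    rwa [map_natCast] at h
  have hinv := aut_hom_comp_baseChange_gluedMk 𝒯 ρ hcov R' σ hσ
  have h := ρ.isGeometricQuotient_baseChange_of_isUnit_card (ρ.isGeometricQuotient_gluedMk hcov) hG'
    (isPullback_baseChange_gluedMk 𝒯 ρ hcov R') ⟨σ.aut, hinv⟩ hσ
  exact (σ.isGeometricQuotient_overMap_iff _ hinv _).mp h

/-! ### §2 The quotient is an integral model of any geometric quotient of the generic fibre -/

/-- **The quotient of the total space of a model is an integral model of the quotient of the
generic fibre.** Let `K` be a field, flat as an `R`-algebra (e.g. `K = Frac R` of a domain), `σ` an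
action of `G` on the generic fibre `𝒯 ×_R K` over `K` lying over `ρ`, and `q : 𝒯 ×_R K → X` ANY
geometric quotient by `G` onto a separated `K`-scheme `X` (Mumford's conditions (1), (2)). Then there
are an integral model `𝒳` of `X` over `R` and a morphism of `R`-schemes `ū : 𝒯 → 𝒳.total` with:
(i)/(ii) TRANSFER — `𝒳.total → Spec R` IS `𝒯/G → Spec R` (`ρ.gluedDesc`) and `ū` IS `π`
(`ρ.gluedMk hcov`), stated as `∀ P : MorphismProperty Scheme, P (…glued form…) → P (…model form…)`
(so ★ `isFinite_gluedMk`, `isAffineHom_gluedMk`, `isProper_gluedDesc`, flatness, smoothness, …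
transfer by name); (iii) the generic fibre of `ū` followed by `𝒳.genericIso` is `q`; (iv) the
generic fibre of `ū` is a geometric quotient (SGA 1 V 1.9); (v) so is every FLAT base change of `ū`;
(vi) if `|G| ∈ Rˣ`, so is EVERY base change of `ū` — in particular the reduction
`𝒳.reduction 𝔪 = (𝒯/G) ×_R R/𝔪` is the quotient of `𝒯 ×_R R/𝔪` ([MFK94] 1.3). The model is
`𝒯/G` with `genericIso` the unique isomorphism of geometric quotients `(𝒯/G) ×_R K ≅ X` under
`𝒯 ×_R K` (★ `IsGeometricQuotient.uniqueUpToIso`). [cite: SGA1, Exp. V Prop. 1.9]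
[cite: MumfordAV1970, §7 Thm. p. 66] [cite: SerreTate1968, §1] -/
theorem exists_integralModel_of_isGeometricQuotient {K : Type u} [Field K] [Algebra R K]
    [Module.Flat R K] {X : SchemeOver K} [IsSeparated X.hom]
    (σ : ActionOver ((baseChange R K).obj 𝒯).hom G)
    (hσ : ∀ g : G, (σ.aut g).hom ≫ pullback.fst 𝒯.hom (Spec.map (CommRingCat.ofHom (algebraMap R K))) =
      pullback.fst 𝒯.hom (Spec.map (CommRingCat.ofHom (algebraMap R K))) ≫ (ρ.aut g).hom)
    (q : ((baseChange R K).obj 𝒯).left ⟶ X.left) (hqX : q ≫ X.hom = ((baseChange R K).obj 𝒯).hom)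
    (hq : σ.IsGeometricQuotient q) :
    ∃ (𝒳 : IntegralModel R K X) (ū : 𝒯 ⟶ 𝒳.total),
      (∀ P : MorphismProperty Scheme.{u}, P (ρ.gluedDesc 𝒯.hom ρ.aut_comp) → P 𝒳.total.hom) ∧
      (∀ P : MorphismProperty Scheme.{u}, P (ρ.gluedMk hcov) → P ū.left) ∧
      ((baseChange R K).map ū).left ≫ 𝒳.genericIso.hom.left = q ∧
      σ.IsGeometricQuotient ((baseChange R K).map ū).left ∧
      (∀ (R' : Type u) [CommRing R'] [Algebra R R'] [Module.Flat R R']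
          (σ' : ActionOver ((baseChange R R').obj 𝒯).hom G),
          (∀ g : G, (σ'.aut g).hom ≫ pullback.fst 𝒯.hom (Spec.map (CommRingCat.ofHom (algebraMap R R'))) =
            pullback.fst 𝒯.hom (Spec.map (CommRingCat.ofHom (algebraMap R R'))) ≫ (ρ.aut g).hom) →
          σ'.IsGeometricQuotient ((baseChange R R').map ū).left) ∧
      (IsUnit ((Nat.card G : ℕ) : R) → ∀ (R' : Type u) [CommRing R'] [Algebra R R']
          (σ' : ActionOver ((baseChange R R').obj 𝒯).hom G),
          (∀ g : G, (σ'.aut g).hom ≫ pullback.fst 𝒯.hom (Spec.map (CommRingCat.ofHom (algebraMap R R'))) =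
            pullback.fst 𝒯.hom (Spec.map (CommRingCat.ofHom (algebraMap R R'))) ≫ (ρ.aut g).hom) →
          σ'.IsGeometricQuotient ((baseChange R R').map ū).left) := by
  set ū : 𝒯 ⟶ Over.mk (ρ.gluedDesc 𝒯.hom ρ.aut_comp) :=
    Over.homMk (ρ.gluedMk hcov) (ρ.gluedMk_gluedDesc hcov 𝒯.hom ρ.aut_comp) with hū
  -- the generic fibre of `π` is a geometric quotient
  have hq₁ : σ.IsGeometricQuotient ((baseChange R K).map ū).left :=
    isGeometricQuotient_baseChange_gluedMk_of_flat 𝒯 ρ hcov K σ hσ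
  -- both targets are separated schemes
  haveI : IsSeparated (ρ.gluedDesc 𝒯.hom ρ.aut_comp) := ρ.isSeparated_gluedDesc hcov 𝒯.hom ρ.aut_comp
  haveI : IsSeparated ((baseChange R K).obj (Over.mk (ρ.gluedDesc 𝒯.hom ρ.aut_comp))).hom := by
    change IsSeparated (pullback.snd (ρ.gluedDesc 𝒯.hom ρ.aut_comp) _)
    infer_instance
  haveI hsep₁ : ((baseChange R K).obj (Over.mk (ρ.gluedDesc 𝒯.hom ρ.aut_comp))).left.IsSeparated :=
    ⟨by rw [← terminal.comp_from ((baseChange R K).obj (Over.mk (ρ.gluedDesc 𝒯.hom ρ.aut_comp))).hom]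
        infer_instance⟩
  haveI hsep₂ : X.left.IsSeparated := ⟨by rw [← terminal.comp_from X.hom]; infer_instance⟩
  -- the canonical isomorphism of geometric quotients, over `K`
  let e : ((baseChange R K).obj (Over.mk (ρ.gluedDesc 𝒯.hom ρ.aut_comp))).left ≅ X.left :=
    hq₁.uniqueUpToIso hq
  have he₁ : ((baseChange R K).map ū).left ≫ e.hom = q := hq₁.comp_uniqueUpToIso_hom hq
  have he : e.hom ≫ X.hom = ((baseChange R K).obj (Over.mk (ρ.gluedDesc 𝒯.hom ρ.aut_comp))).hom := by
    apply hq₁.desc_unique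
    rw [reassoc_of% he₁, hqX]
    exact (Over.w ((baseChange R K).map ū)).symm
  let 𝒳 : IntegralModel R K X := ⟨Over.mk (ρ.gluedDesc 𝒯.hom ρ.aut_comp), Over.isoMk e he⟩
  refine ⟨𝒳, ū, fun _ h => h, fun _ h => h, he₁, hq₁, ?_, ?_⟩
  · intro R' _ _ _ σ' hσ'
    exact isGeometricQuotient_baseChange_gluedMk_of_flat 𝒯 ρ hcov R' σ' hσ'
  · intro hG R' _ _ σ' hσ'
    exact isGeometricQuotient_baseChange_gluedMk_of_isUnit_card 𝒯 ρ hcov hG R' σ' hσ'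

end Quotient

/-! ### §2b The proper case -/

section Proper

variable {R : Type u} [CommRing R] [IsNoetherianRing R] {G : Type*} [Group G] [Finite G]
  (𝒯 : SchemeOver R) [IsProper 𝒯.hom] (ρ : ActionOver 𝒯.hom G)
  (hcov : ∀ x : 𝒯.left, ∃ O : ρ.StableAffineOpens, x ∈ O.1)

set_option backward.isDefEq.respectTransparency false

/-- **Proper case** (SGA 1, Exp. V, Cor. 1.5): under the hypotheses of
`exists_integralModel_of_isGeometricQuotient`, if moreover `R` is Noetherian and `𝒯 → Spec R` is
proper, the model `𝒳.total → Spec R` is PROPER (★ `ActionOver.isProper_gluedDesc`) and `ū` is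
finite and surjective (★ `isFinite_gluedMk`, `surjective_gluedDesc`); together with smoothness
(proved elsewhere for tame actions on smooth relative curves) this is the input of
`IntegralModel.IsSmoothProper`. [cite: SGA1, Exp. V Cor. 1.5] [cite: SerreTate1968, §1] -/
theorem exists_integralModel_of_isGeometricQuotient_of_isProper
    {K : Type u} [Field K] [Algebra R K] [Module.Flat R K] {X : SchemeOver K} [IsSeparated X.hom]
    (σ : ActionOver ((baseChange R K).obj 𝒯).hom G)
    (hσ : ∀ g : G, (σ.aut g).hom ≫ pullback.fst 𝒯.hom (Spec.map (CommRingCat.ofHom (algebraMap R K))) =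
      pullback.fst 𝒯.hom (Spec.map (CommRingCat.ofHom (algebraMap R K))) ≫ (ρ.aut g).hom)
    (q : ((baseChange R K).obj 𝒯).left ⟶ X.left) (hqX : q ≫ X.hom = ((baseChange R K).obj 𝒯).hom)
    (hq : σ.IsGeometricQuotient q) :
    ∃ (𝒳 : IntegralModel R K X) (ū : 𝒯 ⟶ 𝒳.total),
      (∀ P : MorphismProperty Scheme.{u}, P (ρ.gluedDesc 𝒯.hom ρ.aut_comp) → P 𝒳.total.hom) ∧
      (∀ P : MorphismProperty Scheme.{u}, P (ρ.gluedMk hcov) → P ū.left) ∧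
      IsProper 𝒳.total.hom ∧ IsFinite ū.left ∧ Surjective ū.left ∧
      ((baseChange R K).map ū).left ≫ 𝒳.genericIso.hom.left = q ∧
      σ.IsGeometricQuotient ((baseChange R K).map ū).left ∧
      (∀ (R' : Type u) [CommRing R'] [Algebra R R'] [Module.Flat R R']
          (σ' : ActionOver ((baseChange R R').obj 𝒯).hom G),
          (∀ g : G, (σ'.aut g).hom ≫ pullback.fst 𝒯.hom (Spec.map (CommRingCat.ofHom (algebraMap R R'))) =
            pullback.fst 𝒯.hom (Spec.map (CommRingCat.ofHom (algebraMap R R'))) ≫ (ρ.aut g).hom) →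
          σ'.IsGeometricQuotient ((baseChange R R').map ū).left) ∧
      (IsUnit ((Nat.card G : ℕ) : R) → ∀ (R' : Type u) [CommRing R'] [Algebra R R']
          (σ' : ActionOver ((baseChange R R').obj 𝒯).hom G),
          (∀ g : G, (σ'.aut g).hom ≫ pullback.fst 𝒯.hom (Spec.map (CommRingCat.ofHom (algebraMap R R'))) =
            pullback.fst 𝒯.hom (Spec.map (CommRingCat.ofHom (algebraMap R R'))) ≫ (ρ.aut g).hom) →
          σ'.IsGeometricQuotient ((baseChange R R').map ū).left) := by
  obtain ⟨𝒳, ū, h₁, h₂, h₃, h₄, h₅, h₆⟩ :=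
    exists_integralModel_of_isGeometricQuotient 𝒯 ρ hcov σ hσ q hqX hq
  have hP : IsProper (ρ.gluedDesc 𝒯.hom ρ.aut_comp) :=
    ρ.isProper_gluedDesc hcov 𝒯.hom ρ.aut_comp (𝟙 _) (Category.comp_id _)
  exact ⟨𝒳, ū, h₁, h₂, h₁ _ hP, h₂ _ (ρ.isFinite_gluedMk hcov), h₂ _ (ρ.surjective_gluedMk hcov),
    h₃, h₄, h₅, h₆⟩

end Proper

/-! ### §3 Starting from an integral model `𝒳₁` of a `K`-scheme `X₁` with a `G`-action -/

section Model

variable {R : Type u} [CommRing R] {K : Type u} [Field K] [Algebra R K] [Module.Flat R K]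
  {G : Type*} [Group G] [Finite G]
  {X₁ : SchemeOver K} (𝒳₁ : IntegralModel R K X₁) [IsSeparated 𝒳₁.total.hom]
  (ρ : ActionOver 𝒳₁.total.hom G) (hcov : ∀ x : 𝒳₁.total.left, ∃ O : ρ.StableAffineOpens, x ∈ O.1)

set_option backward.isDefEq.respectTransparency false

/-- **Quotient of an integral model.** Let `𝒳₁` be an integral model over `R` of the `K`-scheme `X₁`
(`K` a field flat over `R`), separated over `R`, with an action `ρ` of the finite group `G` by
`R`-automorphisms admitting a cover by `G`-stable opens affine over `R`; let `σ` be an action of `G` on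
`X₁` over `K` which agrees with `ρ` on the generic fibre through `𝒳₁.genericIso`, and `q : X₁ → X` a
geometric quotient by `G` onto a separated `K`-scheme (e.g. a Galois level-lowering map). Then
`𝒳₁.total/G` is an integral model `𝒳` of `X`: there is a morphism of models `ū : 𝒳₁.total → 𝒳.total`
(IS `π`, transfer clause (ii); `𝒳.total → Spec R` IS `𝒳₁.total/G → Spec R`, clause (i)) whose generic
fibre, read through the two `genericIso`s, is `q` (iii) and is a geometric quotient of `X₁` (iv); every
flat base change of `ū` is a geometric quotient (v), and if `|G| ∈ Rˣ` so is every base change — in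
particular `𝒳.reduction 𝔪` is the quotient of `𝒳₁.reduction 𝔪` (vi). [cite: SGA1, Exp. V Prop. 1.9]
[cite: MumfordFogartyKirwan1994, Ch. 1 §2 Amplification 1.3] [cite: SerreTate1968, §1] -/
theorem IntegralModel.exists_quotient {X : SchemeOver K} [IsSeparated X.hom] (σ : ActionOver X₁.hom G)
    (hσ : ∀ g : G, (σ.aut g).hom ≫ 𝒳₁.genericIso.inv.left ≫
        pullback.fst 𝒳₁.total.hom (Spec.map (CommRingCat.ofHom (algebraMap R K))) =
      (𝒳₁.genericIso.inv.left ≫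
        pullback.fst 𝒳₁.total.hom (Spec.map (CommRingCat.ofHom (algebraMap R K)))) ≫ (ρ.aut g).hom)
    (q : X₁.left ⟶ X.left) (hqX : q ≫ X.hom = X₁.hom) (hq : σ.IsGeometricQuotient q) :
    ∃ (𝒳 : IntegralModel R K X) (ū : 𝒳₁.total ⟶ 𝒳.total),
      (∀ P : MorphismProperty Scheme.{u}, P (ρ.gluedDesc 𝒳₁.total.hom ρ.aut_comp) → P 𝒳.total.hom) ∧
      (∀ P : MorphismProperty Scheme.{u}, P (ρ.gluedMk hcov) → P ū.left) ∧
      𝒳₁.genericIso.inv.left ≫ ((baseChange R K).map ū).left ≫ 𝒳.genericIso.hom.left = q ∧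
      σ.IsGeometricQuotient (𝒳₁.genericIso.inv.left ≫ ((baseChange R K).map ū).left) ∧
      (∀ (R' : Type u) [CommRing R'] [Algebra R R'] [Module.Flat R R']
          (σ' : ActionOver ((baseChange R R').obj 𝒳₁.total).hom G),
          (∀ g : G, (σ'.aut g).hom ≫
              pullback.fst 𝒳₁.total.hom (Spec.map (CommRingCat.ofHom (algebraMap R R'))) =
            pullback.fst 𝒳₁.total.hom (Spec.map (CommRingCat.ofHom (algebraMap R R'))) ≫ (ρ.aut g).hom) →
          σ'.IsGeometricQuotient ((baseChange R R').map ū).left) ∧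
      (IsUnit ((Nat.card G : ℕ) : R) → ∀ (R' : Type u) [CommRing R'] [Algebra R R']
          (σ' : ActionOver ((baseChange R R').obj 𝒳₁.total).hom G),
          (∀ g : G, (σ'.aut g).hom ≫
              pullback.fst 𝒳₁.total.hom (Spec.map (CommRingCat.ofHom (algebraMap R R'))) =
            pullback.fst 𝒳₁.total.hom (Spec.map (CommRingCat.ofHom (algebraMap R R'))) ≫ (ρ.aut g).hom) →
          σ'.IsGeometricQuotient ((baseChange R R').map ū).left) := by
  -- the generic fibre of `𝒳₁` as a bare scheme, identified with `X₁`
  let eL : ((baseChange R K).obj 𝒳₁.total).left ≅ X₁.left :=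
    (Over.forget (Spec (CommRingCat.of K))).mapIso 𝒳₁.genericIso
  have hfst : eL.inv ≫ pullback.fst 𝒳₁.total.hom (Spec.map (CommRingCat.ofHom (algebraMap R K))) =
      𝒳₁.genericIso.inv.left ≫ pullback.fst 𝒳₁.total.hom (Spec.map (CommRingCat.ofHom (algebraMap R K))) :=
    rfl
  have hid : eL.hom ≫ 𝒳₁.genericIso.inv.left = 𝟙 _ := eL.hom_inv_id
  -- the action `σ` transported to the generic fibre of `𝒳₁`
  let τ : G →* Aut ((baseChange R K).obj 𝒳₁.total).left := eL.symm.conjAut.toMonoidHom.comp σ.aut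
  have hτ : ∀ g : G, (τ g).hom = eL.hom ≫ (σ.aut g).hom ≫ eL.inv := fun g => by
    change (eL.symm.conjAut (σ.aut g)).hom = _
    rw [Iso.conjAut_hom, Iso.conj_apply]
    rfl
  have hτ_comp : ∀ g : G, (τ g).hom ≫ ((baseChange R K).obj 𝒳₁.total).hom =
      ((baseChange R K).obj 𝒳₁.total).hom := fun g => by
    rw [hτ, Category.assoc, Category.assoc,
      show eL.inv ≫ ((baseChange R K).obj 𝒳₁.total).hom = X₁.hom from Over.w 𝒳₁.genericIso.inv, σ.aut_comp g]
    exact Over.w 𝒳₁.genericIso.hom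
  let σ₀ : ActionOver ((baseChange R K).obj 𝒳₁.total).hom G := ⟨τ, hτ_comp⟩
  have hσ₀ : ∀ g : G, (σ₀.aut g).hom ≫
      pullback.fst 𝒳₁.total.hom (Spec.map (CommRingCat.ofHom (algebraMap R K))) =
      pullback.fst 𝒳₁.total.hom (Spec.map (CommRingCat.ofHom (algebraMap R K))) ≫ (ρ.aut g).hom := by
    intro g
    change (τ g).hom ≫ _ = _
    rw [hτ]
    simp only [Category.assoc]
    rw [hfst, hσ g]
    simp only [Category.assoc]
    rw [reassoc_of% hid]
  -- `σ₀` and `σ` are intertwined by `eL`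
  have he : ∀ g : G, eL.hom ≫ (σ.aut g).hom = (σ₀.aut g).hom ≫ eL.hom := fun g => by
    change _ = (τ g).hom ≫ eL.hom
    rw [hτ, Category.assoc, Category.assoc, eL.inv_hom_id, Category.comp_id]
  have he' : ∀ g : G, eL.symm.hom ≫ (σ₀.aut g).hom = (σ.aut g).hom ≫ eL.symm.hom := fun g => by
    change eL.inv ≫ (τ g).hom = (σ.aut g).hom ≫ eL.inv
    rw [hτ, eL.inv_hom_id_assoc]
  -- `eL ≫ q` is a geometric quotient of the generic fibre of `𝒳₁`
  have hq₀ : σ₀.IsGeometricQuotient (eL.hom ≫ q) := hq.of_equivariantIso σ₀ eL he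
  have hq₀X : (eL.hom ≫ q) ≫ X.hom = ((baseChange R K).obj 𝒳₁.total).hom := by
    rw [Category.assoc, hqX]
    exact Over.w 𝒳₁.genericIso.hom
  obtain ⟨𝒳, ū, h₁, h₂, h₃, h₄, h₅, h₆⟩ :=
    exists_integralModel_of_isGeometricQuotient 𝒳₁.total ρ hcov σ₀ hσ₀ (eL.hom ≫ q) hq₀X hq₀
  refine ⟨𝒳, ū, h₁, h₂, ?_, ?_, h₅, h₆⟩
  · -- (iii): `genericIso⁻¹ ≫ ū_K ≫ genericIso' = genericIso⁻¹ ≫ eL ≫ q = q`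
    change eL.inv ≫ _ = q
    rw [h₃, eL.inv_hom_id_assoc]
  · -- (iv): transport (iv) of the core back along `eL⁻¹`
    change σ.IsGeometricQuotient (eL.symm.hom ≫ ((baseChange R K).map ū).left)
    exact h₄.of_equivariantIso σ eL.symm he'

end Model

section ModelProper

variable {R : Type u} [CommRing R] [IsNoetherianRing R] {K : Type u} [Field K] [Algebra R K]
  [Module.Flat R K] {G : Type*} [Group G] [Finite G]
  {X₁ : SchemeOver K} (𝒳₁ : IntegralModel R K X₁) [IsProper 𝒳₁.total.hom]
  (ρ : ActionOver 𝒳₁.total.hom G) (hcov : ∀ x : 𝒳₁.total.left, ∃ O : ρ.StableAffineOpens, x ∈ O.1)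

set_option backward.isDefEq.respectTransparency false

/-- **Quotient of a PROPER integral model**: in `IntegralModel.exists_quotient`, if `R` is Noetherian and
`𝒳₁.total → Spec R` is proper then `𝒳.total → Spec R` is proper (SGA 1 V Cor. 1.5) and `ū` is finite
surjective — with smoothness (tame actions on smooth relative curves, proved elsewhere) this gives
`𝒳.IsSmoothProper`. [cite: SGA1, Exp. V Cor. 1.5] [cite: SerreTate1968, §1] -/
theorem IntegralModel.exists_quotient_of_isProper {X : SchemeOver K} [IsSeparated X.hom] (σ : ActionOver X₁.hom G)
    (hσ : ∀ g : G, (σ.aut g).hom ≫ 𝒳₁.genericIso.inv.left ≫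
        pullback.fst 𝒳₁.total.hom (Spec.map (CommRingCat.ofHom (algebraMap R K))) =
      (𝒳₁.genericIso.inv.left ≫
        pullback.fst 𝒳₁.total.hom (Spec.map (CommRingCat.ofHom (algebraMap R K)))) ≫ (ρ.aut g).hom)
    (q : X₁.left ⟶ X.left) (hqX : q ≫ X.hom = X₁.hom) (hq : σ.IsGeometricQuotient q) :
    ∃ (𝒳 : IntegralModel R K X) (ū : 𝒳₁.total ⟶ 𝒳.total),
      (∀ P : MorphismProperty Scheme.{u}, P (ρ.gluedDesc 𝒳₁.total.hom ρ.aut_comp) → P 𝒳.total.hom) ∧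
      (∀ P : MorphismProperty Scheme.{u}, P (ρ.gluedMk hcov) → P ū.left) ∧
      IsProper 𝒳.total.hom ∧ IsFinite ū.left ∧ Surjective ū.left ∧
      𝒳₁.genericIso.inv.left ≫ ((baseChange R K).map ū).left ≫ 𝒳.genericIso.hom.left = q ∧
      σ.IsGeometricQuotient (𝒳₁.genericIso.inv.left ≫ ((baseChange R K).map ū).left) ∧
      (∀ (R' : Type u) [CommRing R'] [Algebra R R'] [Module.Flat R R']
          (σ' : ActionOver ((baseChange R R').obj 𝒳₁.total).hom G),
          (∀ g : G, (σ'.aut g).hom ≫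
              pullback.fst 𝒳₁.total.hom (Spec.map (CommRingCat.ofHom (algebraMap R R'))) =
            pullback.fst 𝒳₁.total.hom (Spec.map (CommRingCat.ofHom (algebraMap R R'))) ≫ (ρ.aut g).hom) →
          σ'.IsGeometricQuotient ((baseChange R R').map ū).left) ∧
      (IsUnit ((Nat.card G : ℕ) : R) → ∀ (R' : Type u) [CommRing R'] [Algebra R R']
          (σ' : ActionOver ((baseChange R R').obj 𝒳₁.total).hom G),
          (∀ g : G, (σ'.aut g).hom ≫
              pullback.fst 𝒳₁.total.hom (Spec.map (CommRingCat.ofHom (algebraMap R R'))) =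
            pullback.fst 𝒳₁.total.hom (Spec.map (CommRingCat.ofHom (algebraMap R R'))) ≫ (ρ.aut g).hom) →
          σ'.IsGeometricQuotient ((baseChange R R').map ū).left) := by
  obtain ⟨𝒳, ū, h₁, h₂, h₃, h₄, h₅, h₆⟩ := 𝒳₁.exists_quotient ρ hcov σ hσ q hqX hq
  have hP : IsProper (ρ.gluedDesc 𝒳₁.total.hom ρ.aut_comp) :=
    ρ.isProper_gluedDesc hcov 𝒳₁.total.hom ρ.aut_comp (𝟙 _) (Category.comp_id _)
  exact ⟨𝒳, ū, h₁, h₂, h₁ _ hP, h₂ _ (ρ.isFinite_gluedMk hcov), h₂ _ (ρ.surjective_gluedMk hcov),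
    h₃, h₄, h₅, h₆⟩

end ModelProper

end Literature.AlgebraicGeometry.Motives

end
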